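/-
Origin: expansion seat `prover-pub-hodgecm-mc-binder-1-g15-0`, handover #R97 2026-08-20T18:37:14Z md5 9f7fe271355f (101 l.; NEW additive universe-free datum-generic leaf; imports #R96 + #R94 only; drop-alone at the bottom; NAME LIST: HodgeCM.Model.HeckeClassLift.coe_cosetRealPoint · HodgeCM.Model.HeckeClassLift.classLift_heckeOpC) (`HOME/mc/pub-hodgecm-mc-binder-1-g15/stage59/HodgeCM/Model/HeckeClassLift.lean`, md5 9f7fe271355f, 101 lines);
landed by the gen-24 packager (p-g24) in gate run 59 as `HodgeCM/Model/HeckeClassLift.lean` (verbatim).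
-/
/-
Copyright (c) 2026 the pub-hodgecm formalisation cell (harness21).  New file, not vendored.
Origin: session prover-pub-hodgecm-mc-binder-1-g15-0 (unit pub-hodgecm-mc-binder-1-g15, BINDER PROVER gen 15 of lineage mc-binder-1;
content lane (J-Liu-Θ), scope memo `HOME/mc/pub-hodgecm-mc-binder-1-g14/JLIU-THETA-SCOPE.md` §9 (J2), HECKE-TOWER sub-leaf (T5):
«(J2) ASSEMBLED, datum-generic: the holomorphic lift intertwines the Hecke operator on cohomology with the sum of translates on the ball»),
2026-08-20.  Intended final place: `HodgeCM/Model/HeckeClassLift.lean` (NEW additive leaf, universe-free, datum-generic; imports ONLY this lane's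
`HodgeCM.Model.HeckeHodgeType` and `HodgeCM.Model.ClassLiftTwist`; nothing imports it; drops with either).
-/
import Summits.HodgeConjecture.HodgeCM.Model.HeckeHodgeType
import Summits.HodgeConjecture.HodgeCM.Model.ClassLiftTwist

set_option autoImplicit false

/-!
# (J2) Matsushima-type equivariance of the holomorphic lift: `lift (T_g ω) = [Γ':N_g]⁻¹ Σ_q (g γ̃_q)^* (lift ω)`

Let `X(ℂ) ≅ Γ\𝔹²` be a compact ball quotient surface with datum `D : UnitaryBallQuotientDatum 2 X`, Sylvester frame `𝔣`, and `g ∈ U(V)(F)` admissible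
for the vendored Hecke correspondence (`IsHeckeAdmissible`; every `g` is, tree `isHeckeAdmissible_of_mem_unitaryGroup`).  GIVEN an algebraic model of the
Hecke level cover — `DN'` a ball uniformization of a smooth projective `XN'` by the same hermitian space with group `N_g` (`Γ_{N'}^{τ₁} = N_g^{τ₁}`), the
projection `π : XN' ⟶ X` over the uniformizations and translates `π_q : XN' ⟶ X` over `v ↦ g γ̃_q v` (`γ̃_q = out q`, `q ∈ Γ/N_g`) — we prove, for every
`ω ∈ F¹(ℂ ⊗ H¹(X(ℂ); ℚ))` (a holomorphic one-form):

  `classLift 𝔣 (T_g ω) = [Γ ∩ g⁻¹Γg : N_g]⁻¹ • Σ_{q ∈ Γ/N_g} h_q^* (classLift 𝔣 ω)`,  `h_q := frameIso 𝔣 ((g γ̃_q)^{τ₁}) ∈ U(2,1)`,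
  `h^* F := factorPullback cotangentCocycle h F : z ↦ (Jac h z)ᵀ F(h z)`

(`classLift_heckeOpC`), i.e. THE HOLOMORPHIC LIFT INTERTWINES `T_g` ON `F¹H¹` WITH THE CLASSICAL HECKE OPERATOR ON HOLOMORPHIC ONE-FORMS ON THE BALL
([Shimura 1971 §8.3 (8.3.2)]; the right-hand side is sinst-1's `BallFormsHecke.hecke cotangentCocycle Γ̃ h (classLift ω)` by its
`sum_factorPullback_mul_out_eq_relIndex_smul_hecke'`, a rewriting left to the junction leaf that imports both).  Assembly of this lane's leaves:
`T_g ω ∈ F¹` (`HeckeHodgeType`), `lift (T_g ω) = lift_{N'} (π^* T_g ω)` (vendored `classLift_pull`), `π^* T_g ω = [Γ':N_g]⁻¹ Σ_q π_q^* ω`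
(`LevelCoverAlgebraic.pull_heckeOpC_eq_sum`), linearity of `classLift`, and `lift_{N'} (π_q^* ω) = h_q^* (lift ω)` (`ClassLiftTwist.classLift_pull_mulVec'`).
What the MODEL must still supply to instantiate the four inputs at `U.pms L ι₁ V Γ` (next leaf, not here): the Hecke level `N_g` as a `Level V` (torsion-free —
clear — and CONGRUENCE: `N_g ⊇ Γ(n·d_g²)`), whence `XN' := U.pms L ι₁ V N_g`, `DN' := ballDatumOf`, `π := coverOf` (glue-1, record `hA`), `π_q` by
`LevelCoveringTwist.exists_hom_map_unif_eq_mulVec hA`.  KIND: kernel theorem; nothing cited anew, nothing minted; 0 proof holes; expected `#print axioms` ⊆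
{propext, Classical.choice, Quot.sound}.

References: G. Shimura, *Introduction to the arithmetic theory of automorphic functions* (1971), §8.3 (8.3.1)–(8.3.2) (action of double cosets on
holomorphic differentials and on cohomology, and their compatibility); Y. Matsushima, S. Murakami, Ann. of Math. 78 (1963) (automorphic forms and
cohomology of `Γ\𝔹`); A. Borel, *Automorphic forms on SL₂(ℝ)* (1997), §5.13–5.14.
-/

noncomputable section

open Matrix MulAction Function Set
open scoped TensorProduct
open CategoryTheory
open Literature.Geometry.ComplexHyperbolic
open Literature.Geometry.ComplexHyperbolic.BallModel (U21 Ball Jac)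
open Literature.AlgebraicGeometry.HodgeTheory
open Literature.AlgebraicGeometry.Motives (SchemeOver ComplexPoints AlgPoints bettiCohomology IsSmoothProjective)

namespace HodgeCM.Model.HeckeClassLift

open Literature.AlgebraicGeometry.ShimuraVarieties UnitaryBallQuotientDatum
open HodgeCM.Model.LevelCovering (frameTransfer)
open HodgeCM.Model.LevelCoverAlgebraic HodgeCM.Model.HeckeHodgeType HodgeCM.Model.ClassLiftTwist

variable {X XN' : SchemeOver ℂ} {D : UnitaryBallQuotientDatum 2 X} {g : GL (Fin 3) D.E} (h : D.IsHeckeAdmissible g)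
  (DN' : UnitaryBallUniformisationDatum 2 XN') (hH' : DN'.Hℂ = D.Hℂ)
  (hΓ' : DN'.Γ.map (Matrix.GeneralLinearGroup.map DN'.τ₁) = ((D.heckeLevel g).map D.Γ.subtype).map (Matrix.GeneralLinearGroup.map D.τ₁))

/-- The real point `(g γ̃)^{τ₁} ∈ U(H^{τ₁})` of a coset representative `g γ̃` of `Γ g Γ` (`g` admissible, `γ̃ ∈ Γ`). [cite: Shimura1973, §3.1] -/
def cosetRealPoint (γ : ↥D.Γ) : D.realPoints :=
  ⟨Matrix.GeneralLinearGroup.map D.τ₁ (g * (γ : GL (Fin 3) D.E)),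
    D.map_τ₁_mem_realPoints (mul_mem h.mem_unitaryGroup (D.isCongruenceSubgroup.1 γ.2))⟩

/-- Its matrix is `(g γ̃)^{τ₁}`, so that `D.act (g γ̃) v = (cosetRealPoint h γ̃) v`. [folklore] -/
theorem coe_cosetRealPoint (γ : ↥D.Γ) :
    (((cosetRealPoint h γ : D.realPoints) : GL (Fin 3) ℂ) : Matrix (Fin 3) (Fin 3) ℂ) =
      ((g * (γ : GL (Fin 3) D.E) : GL (Fin 3) D.E) : Matrix (Fin 3) (Fin 3) D.E).map D.τ₁ := rfl

include h hH' hΓ' in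
/-- **(J2) The holomorphic lift intertwines `T_g` with the sum of translates**: for `ω ∈ F¹H¹(X)` and an algebraic model `(XN', DN', π, π_q)` of the Hecke
level cover, `classLift 𝔣 (T_g ω) = [Γ ∩ g⁻¹Γg : N_g]⁻¹ • Σ_{q ∈ Γ/N_g} h_q^* (classLift 𝔣 ω)` with `h_q = frameIso 𝔣 ((g γ̃_q)^{τ₁})`.
[cite: Shimura1973, §8.3] [cite: Borel1997, §5.13–5.14] -/
theorem classLift_heckeOpC (hHD : exists_isReal_hodgeModel) (hI : hodgePQ_independent_of_hodgeModel) (𝔣 : D.SylvesterFrame)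
    (π : XN' ⟶ X) (hπ : ∀ v ∈ DN'.cone, AlgPoints.map π (DN'.unif v) = D.unif v)
    (πq : ↥D.Γ ⧸ D.heckeLevel g → (XN' ⟶ X))
    (hπq : ∀ q, ∀ v ∈ DN'.cone, v ∈ D.cone →
      AlgPoints.map (πq q) (DN'.unif v) = D.unif (D.act (g * ((Quotient.out q : ↥D.Γ) : GL (Fin 3) D.E)) v))
    {ω : ℂ ⊗[ℚ] bettiCohomology X 1} (hω : ω ∈ (BettiUniverse.hodge hHD D.isSmoothProjective 1).F 1) :
    letI : (D.heckeLevel g).FiniteIndex := h.finiteIndex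
    letI : Fintype (↥D.Γ ⧸ D.heckeLevel g) := Subgroup.fintypeQuotientOfFiniteIndex
    D.classLift hHD 𝔣 (heckeOpC D D.isSmoothProjective 1 g ω) =
      ((D.heckeIndex g : ℂ)⁻¹) • ∑ q : ↥D.Γ ⧸ D.heckeLevel g,
        BallForms.factorPullback BallForms.cotangentCocycle (D.frameIso 𝔣 (cosetRealPoint h (Quotient.out q))) (D.classLift hHD 𝔣 ω) := by
  haveI : (D.heckeLevel g).FiniteIndex := h.finiteIndex
  letI : Fintype (↥D.Γ ⧸ D.heckeLevel g) := Subgroup.fintypeQuotientOfFiniteIndex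
  -- `T_g ω` is again in `F¹`
  have hT := heckeOpC_mem_hodge_F_one h DN' hH' hΓ' hHD hI D.isSmoothProjective π hπ πq hπq hω
  -- read the lift at level `N_g` through `π`
  have hH'' : DN'.Hℂ = D.toUnitaryBallUniformisationDatum.Hℂ := hH'
  rw [← D.toUnitaryBallUniformisationDatum.classLift_pull hHD 𝔣 hI DN' (frameTransfer DN' hH'' 𝔣) π rfl hπ hT,
    pull_heckeOpC_eq_sum h DN' hH' hΓ' D.isSmoothProjective π hπ πq hπq 1 ω, map_smul, map_sum]
  congr 1
  refine Finset.sum_congr rfl fun q _ ↦ ?_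
  exact classLift_pull_mulVec' DN' (frameTransfer DN' hH'' 𝔣) (cosetRealPoint h (Quotient.out q)) hHD hI rfl
    (fun v hv ↦ hπq q v hv (by change v ∈ negCone D.Hℂ; rw [← hH']; exact hv)) hω

end HodgeCM.Model.HeckeClassLift

end
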